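import Summits.QuantumFields.GaugeBoot.Targets
import Literature.MathematicalPhysics.QuantumFieldTheory.SU2WilsonCharacterCoefficients
import Literature.MathematicalPhysics.QuantumFieldTheory.StrongCouplingActivities
import Literature.MathematicalPhysics.QuantumLattice.SU2Haar
import Mathlib.MeasureTheory.Group.Integral
import HarnessLib

/-!
# Gauge-boot: the one-link mean of `SU(2)` — `E[W] = (I₂/I₁)(βκ) · V†` for the weight `exp((β/2) Re tr(W K))`, `K = κV`

Cell `ym-instrument` (HOME `run/shared/lean/pub/ym-instrument/`), crew (a), seat `ym-instrument-boot-lean-1`;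
A-plan-11 «BESSEL CAP» typing, file 3/6 (the analytic tool: Creutz's `SU(2)` heat-bath mean).

HONEST FRAMING (page 1 of every file of this cell): one-variable / one-link `SU(2)` integrals only; no statement
about any lattice gauge theory at any `(G, D, L, β)`; nothing summit-bearing.

## Content (`SU 2 = Matrix.specialUnitaryGroup (Fin 2) ℂ`, `dW` = `haarProbability (SU 2)`)

* §1 Entries of `W ∈ SU(2)`: `W = [[a, b], [-b̄, ā]]` (tree `SU2Haar.su2_apply_10/11`), and the decomposition
  `Re tr(W C) = Re a · Re tr C + Im a · κ₁(C) + Re b · κ₂(C) - Im b · κ₃(C)` for every `C ∈ M₂(ℂ)`.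
* §2 The three ODD coordinates `Im a, Re b, Im b` change sign under conjugation by the `SU(2)` elements
  `J = [[0,1],[-1,0]]` resp. `D = diag(i, -i)`, which preserve Haar measure and every class function; hence
  `∫ Re tr(W C) φ(Re tr W) dW = ½ Re tr C · ∫ Re tr W φ(Re tr W) dW` (`integral_re_trace_mul_weight`): **the
  matrix-valued mean of a class-function weight is scalar.**
* §3 The one-link numerator/denominator `N(B) = ∫ ½Re tr W e^{B Re tr W} dW`, `Z(B) = ∫ e^{B Re tr W} dW > 0` and the
  mean `linkMean B = N(B)/Z(B)`; by the tree's Bessel identities (`SU2OneLink.integral_re_trace_mul_exp_div_eq`,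
  Montvay–Münster (3.173), (7.69)) `linkMean B = I₂(2B)/I₁(2B)` for `B > 0`, `linkMean 0 = 0`, `0 ≤ linkMean B`, and
  a bound `I₂/I₁ ≤ ρ` on `(0, 2B_max]` transfers to `linkMean B ≤ ρ` for `0 ≤ B ≤ B_max`.
* §4 Polar form of a quaternion matrix `quatMatrix k = ‖k‖ · quatToSU2 k` (tree `SU2Haar`) and **the one-link mean
  against a quaternionic source** (Creutz, Phys. Rev. D 21 (1980) 2308, §III eq. (17)–(22); K. Wilson 1974):
  for `t ≥ 0`, `k ∈ ℍ`, `S ∈ SU(2)`,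
  `∫ Re tr(W S) e^{t Re tr(W·quatMatrix k)} dW = linkMean (t‖k‖) · Re tr(V⁻¹ S) · ∫ e^{t Re tr(W·quatMatrix k)} dW`,
  `V = quatToSU2 k` (`integral_re_trace_mul_exp_source`) — the conditional mean of a link given its staples is
  `linkMean(t‖k‖) · V†`.

All statements are proved; no named facts.
-/

noncomputable section

open MeasureTheory Complex
open Literature.MathematicalPhysics.QuantumFieldTheory
open Literature.RepresentationTheory.CompactGroups
open Literature.MathematicalPhysics.QuantumLattice (quatMatrix quatToSU2 su2_apply_10 su2_apply_11 coe_quatToSU2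
  quatMatrix_smul quatMatrix_one)
open Literature.Analysis.FunctionSpaces (besselI)

namespace Summit.QuantumFields.GaugeBoot

namespace SU2OneLink

/-! ## §1 Entries of an `SU(2)` matrix and the trace against a fixed matrix -/

/-- `Re tr W = 2 Re W₀₀` for `W ∈ SU(2)` (`W₁₁ = conj W₀₀`). [folklore] -/
theorem trace_re_eq (W : SU 2) : (W.1.trace).re = 2 * (W.1 0 0).re := by
  rw [Matrix.trace_fin_two, Complex.add_re, su2_apply_11, Complex.conj_re]
  ring

/-- **`Re tr(W C)` in the coordinates `a = W₀₀`, `b = W₀₁`**: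
`Re tr(W C) = Re a · Re tr C + Im a · (Im C₁₁ - Im C₀₀) + Re b · (Re C₁₀ - Re C₀₁) - Im b · (Im C₁₀ + Im C₀₁)`. [folklore] -/
theorem re_trace_mul (W : SU 2) (C : Matrix (Fin 2) (Fin 2) ℂ) :
    (W.1 * C).trace.re = (W.1 0 0).re * C.trace.re + (W.1 0 0).im * ((C 1 1).im - (C 0 0).im) +
      (W.1 0 1).re * ((C 1 0).re - (C 0 1).re) - (W.1 0 1).im * ((C 1 0).im + (C 0 1).im) := by
  rw [Matrix.trace_fin_two, Matrix.trace_fin_two, Matrix.mul_apply, Matrix.mul_apply, Fin.sum_univ_two,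
    Fin.sum_univ_two, su2_apply_10, su2_apply_11]
  simp only [Complex.add_re, Complex.mul_re, Complex.neg_re, Complex.neg_im, Complex.conj_re, Complex.conj_im]
  ring

/-! ## §2 Conjugation symmetries: the odd coordinates integrate to zero against class-function weights -/

/-- `D = diag(i, -i) ∈ SU(2)`. [folklore] -/
def dMat : SU 2 :=
  ⟨!![I, 0; 0, -I], by
    rw [Matrix.mem_specialUnitaryGroup_iff, Matrix.mem_unitaryGroup_iff]
    refine ⟨?_, by simp [Matrix.det_fin_two]⟩
    ext i j
    fin_cases i <;> fin_cases j <;> simp [Matrix.mul_apply, Fin.sum_univ_two, Matrix.star_apply]⟩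

/-- `J = [[0, 1], [-1, 0]] ∈ SU(2)`. [folklore] -/
def jMat : SU 2 :=
  ⟨!![0, 1; -1, 0], by
    rw [Matrix.mem_specialUnitaryGroup_iff, Matrix.mem_unitaryGroup_iff]
    refine ⟨?_, by simp [Matrix.det_fin_two]⟩
    ext i j
    fin_cases i <;> fin_cases j <;> simp [Matrix.mul_apply, Fin.sum_univ_two, Matrix.star_apply]⟩

/-- The matrix of a conjugate `V W V⁻¹` (the inverse in `SU(2)` is the conjugate transpose). [folklore] -/
theorem coe_conj (V W : SU 2) : (V * W * V⁻¹).1 = V.1 * W.1 * star V.1 := rfl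

/-- Conjugation by `D`: `(D W D⁻¹)₀₀ = W₀₀`. [folklore] -/
theorem dMat_conj_apply_00 (W : SU 2) : (dMat * W * dMat⁻¹).1 0 0 = W.1 0 0 := by
  rw [coe_conj]
  simp only [Matrix.mul_apply, Fin.sum_univ_two, Matrix.star_apply]
  simp [dMat]
  linear_combination (-(W.1 0 0)) * Complex.I_mul_I

/-- Conjugation by `D`: `(D W D⁻¹)₀₁ = -W₀₁`. [folklore] -/
theorem dMat_conj_apply_01 (W : SU 2) : (dMat * W * dMat⁻¹).1 0 1 = -W.1 0 1 := by
  rw [coe_conj]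
  simp only [Matrix.mul_apply, Fin.sum_univ_two, Matrix.star_apply]
  simp [dMat]
  linear_combination (W.1 0 1) * Complex.I_mul_I

/-- Conjugation by `J`: `(J W J⁻¹)₀₀ = conj W₀₀`. [folklore] -/
theorem jMat_conj_apply_00 (W : SU 2) : (jMat * W * jMat⁻¹).1 0 0 = (starRingEnd ℂ) (W.1 0 0) := by
  rw [coe_conj]
  simp only [Matrix.mul_apply, Fin.sum_univ_two, Matrix.star_apply]
  simp [jMat, su2_apply_11]

/-- The trace is a class function: `Re tr(V W V⁻¹) = Re tr W`. [folklore] -/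
theorem trace_re_conj (V W : SU 2) : ((V * W * V⁻¹).1.trace).re = (W.1.trace).re := by
  rw [coe_conj, Matrix.trace_mul_cycle, V.2.1.1, one_mul]

/-- **Odd functions under a conjugation integrate to zero**: if `f(V W V⁻¹) = -f(W)` for all `W`, then
`∫ f dW = 0` (left and right invariance of Haar measure on the compact group `SU(2)`). [folklore] -/
theorem integral_eq_zero_of_conj (V : SU 2) {f : SU 2 → ℝ} (h : ∀ W, f (V * W * V⁻¹) = -f W) :
    ∫ W, f W ∂(haarProbability (SU 2)) = 0 := by
  have h1 : ∫ W, f (V * W * V⁻¹) ∂(haarProbability (SU 2)) = ∫ W, f W ∂(haarProbability (SU 2)) := by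
    have hl : ∫ W, f (V * W * V⁻¹) ∂(haarProbability (SU 2)) = ∫ W, f (W * V⁻¹) ∂(haarProbability (SU 2)) :=
      integral_mul_left_eq_self (μ := haarProbability (SU 2)) (fun W => f (W * V⁻¹)) V
    rw [hl]
    exact integral_mul_right_eq_self f V⁻¹
  have h2 : ∫ W, f (V * W * V⁻¹) ∂(haarProbability (SU 2)) = -∫ W, f W ∂(haarProbability (SU 2)) := by
    simp_rw [h]
    exact integral_neg f
  linarith

/-- Continuous real functions on `SU(2)` are Haar-integrable. [folklore] -/
theorem integrable_of_continuous {f : SU 2 → ℝ} (hf : Continuous f) : Integrable f (haarProbability (SU 2)) :=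
  hf.integrable_of_hasCompactSupport (HasCompactSupport.of_compactSpace f)

/-- The entry maps `W ↦ W i j` are continuous. [folklore] -/
theorem continuous_apply_entry (i j : Fin 2) : Continuous fun W : SU 2 => W.1 i j :=
  continuous_subtype_val.matrix_elem i j

/-- `W ↦ Re tr W` is continuous. [folklore] -/
theorem continuous_trace_re : Continuous fun W : SU 2 => (W.1.trace).re :=
  Complex.continuous_re.comp (continuous_subtype_val.matrix_trace)

/-- `∫ Im W₀₀ · φ(Re tr W) dW = 0` (odd under conjugation by `J`). [folklore] -/
theorem integral_im00_mul_eq_zero (φ : ℝ → ℝ) :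
    ∫ W, (W.1 0 0).im * φ ((W.1.trace).re) ∂(haarProbability (SU 2)) = 0 := by
  refine integral_eq_zero_of_conj jMat fun W => ?_
  rw [jMat_conj_apply_00, trace_re_conj, Complex.conj_im]
  ring

/-- `∫ Re W₀₁ · φ(Re tr W) dW = 0` (odd under conjugation by `D`). [folklore] -/
theorem integral_re01_mul_eq_zero (φ : ℝ → ℝ) :
    ∫ W, (W.1 0 1).re * φ ((W.1.trace).re) ∂(haarProbability (SU 2)) = 0 := by
  refine integral_eq_zero_of_conj dMat fun W => ?_
  rw [dMat_conj_apply_01, trace_re_conj, Complex.neg_re]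
  ring

/-- `∫ Im W₀₁ · φ(Re tr W) dW = 0` (odd under conjugation by `D`). [folklore] -/
theorem integral_im01_mul_eq_zero (φ : ℝ → ℝ) :
    ∫ W, (W.1 0 1).im * φ ((W.1.trace).re) ∂(haarProbability (SU 2)) = 0 := by
  refine integral_eq_zero_of_conj dMat fun W => ?_
  rw [dMat_conj_apply_01, trace_re_conj, Complex.neg_im]
  ring

/-- **The matrix mean of a class-function weight is scalar**: for continuous `φ` and any `C ∈ M₂(ℂ)`,
`∫ Re tr(W C) φ(Re tr W) dW = ½ Re tr C · ∫ Re tr W φ(Re tr W) dW`. [folklore] -/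
theorem integral_re_trace_mul_weight (C : Matrix (Fin 2) (Fin 2) ℂ) (φ : ℝ → ℝ) (hφ : Continuous φ) :
    ∫ W, (W.1 * C).trace.re * φ ((W.1.trace).re) ∂(haarProbability (SU 2)) =
      1 / 2 * C.trace.re * ∫ W, (W.1.trace).re * φ ((W.1.trace).re) ∂(haarProbability (SU 2)) := by
  have hφW : Continuous fun W : SU 2 => φ ((W.1.trace).re) := hφ.comp continuous_trace_re
  -- names for the four coefficients (so that no raw matrix entry of `C` is left in the goals)
  obtain ⟨T, hT⟩ : ∃ T : ℝ, T = C.trace.re := ⟨_, rfl⟩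
  obtain ⟨κ₁, hκ₁⟩ : ∃ κ : ℝ, κ = (C 1 1).im - (C 0 0).im := ⟨_, rfl⟩
  obtain ⟨κ₂, hκ₂⟩ : ∃ κ : ℝ, κ = (C 1 0).re - (C 0 1).re := ⟨_, rfl⟩
  obtain ⟨κ₃, hκ₃⟩ : ∃ κ : ℝ, κ = (C 1 0).im + (C 0 1).im := ⟨_, rfl⟩
  rw [← hT]
  -- the integrand, split into the scalar part and three odd parts
  have hsplit : ∀ W : SU 2, (W.1 * C).trace.re * φ ((W.1.trace).re) =
      1 / 2 * T * ((W.1.trace).re * φ ((W.1.trace).re)) + (κ₁ * ((W.1 0 0).im * φ ((W.1.trace).re)) +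
        (κ₂ * ((W.1 0 1).re * φ ((W.1.trace).re)) + -κ₃ * ((W.1 0 1).im * φ ((W.1.trace).re)))) := by
    intro W
    rw [re_trace_mul, trace_re_eq, ← hT, ← hκ₁, ← hκ₂, ← hκ₃]
    ring
  have i0 : Integrable (fun W : SU 2 => 1 / 2 * T * ((W.1.trace).re * φ ((W.1.trace).re)))
      (haarProbability (SU 2)) := (integrable_of_continuous (continuous_trace_re.mul hφW)).const_mul _
  have i1 : Integrable (fun W : SU 2 => κ₁ * ((W.1 0 0).im * φ ((W.1.trace).re))) (haarProbability (SU 2)) :=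
    (integrable_of_continuous ((Complex.continuous_im.comp (continuous_apply_entry 0 0)).mul hφW)).const_mul _
  have i2 : Integrable (fun W : SU 2 => κ₂ * ((W.1 0 1).re * φ ((W.1.trace).re))) (haarProbability (SU 2)) :=
    (integrable_of_continuous ((Complex.continuous_re.comp (continuous_apply_entry 0 1)).mul hφW)).const_mul _
  have i3 : Integrable (fun W : SU 2 => -κ₃ * ((W.1 0 1).im * φ ((W.1.trace).re))) (haarProbability (SU 2)) :=
    (integrable_of_continuous ((Complex.continuous_im.comp (continuous_apply_entry 0 1)).mul hφW)).const_mul _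
  have i23 : Integrable (fun W : SU 2 => κ₂ * ((W.1 0 1).re * φ ((W.1.trace).re)) +
      -κ₃ * ((W.1 0 1).im * φ ((W.1.trace).re))) (haarProbability (SU 2)) := i2.add i3
  have i123 : Integrable (fun W : SU 2 => κ₁ * ((W.1 0 0).im * φ ((W.1.trace).re)) +
      (κ₂ * ((W.1 0 1).re * φ ((W.1.trace).re)) + -κ₃ * ((W.1 0 1).im * φ ((W.1.trace).re))))
      (haarProbability (SU 2)) := i1.add i23
  rw [integral_congr_ae (Filter.Eventually.of_forall hsplit), integral_add i0 i123, integral_add i1 i23,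
    integral_add i2 i3, integral_const_mul, integral_const_mul, integral_const_mul, integral_const_mul,
    integral_im00_mul_eq_zero, integral_re01_mul_eq_zero, integral_im01_mul_eq_zero]
  ring

/-! ## §3 The one-link mean `linkMean B = I₂(2B)/I₁(2B)` -/

/-- The one-link partition function `Z(B) = ∫ e^{B Re tr W} dW` (`= I₁(2B)/B`, tree
`SU2OneLink.integral_exp_mul_re_trace_eq_besselI`). [folklore] -/
def linkZ (B : ℝ) : ℝ := ∫ W, Real.exp (B * (W.1.trace).re) ∂(haarProbability (SU 2))

/-- The one-link numerator `N(B) = ∫ ½ Re tr W · e^{B Re tr W} dW` (`= I₂(2B)/B`). [folklore] -/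
def linkN (B : ℝ) : ℝ := ∫ W, 1 / 2 * (W.1.trace).re * Real.exp (B * (W.1.trace).re) ∂(haarProbability (SU 2))

/-- **The one-link mean** `linkMean B = E_B[½ Re tr W] = N(B)/Z(B)` of the law `∝ e^{B Re tr W} dW` (Creutz 1980
§III: the heat-bath mean of `½ tr U` at effective coupling `B`). [folklore] -/
def linkMean (B : ℝ) : ℝ := linkN B / linkZ B

/-- `Z(B) ≥ e^{-2|B|} > 0` (`|Re tr W| ≤ 2`). [folklore] -/
theorem linkZ_pos (B : ℝ) : 0 < linkZ B := by
  have hle : ∀ W : SU 2, Real.exp (-(2 * |B|)) ≤ Real.exp (B * (W.1.trace).re) := by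
    intro W
    refine Real.exp_le_exp.2 ?_
    have h := CompactGroup.abs_re_trace_le_card (suRep 2) (continuous_suRep 2) W
    rw [Fintype.card_fin] at h
    have h' : |B * (W.1.trace).re| ≤ |B| * 2 := by
      rw [abs_mul]; exact mul_le_mul_of_nonneg_left (by simpa using h) (abs_nonneg _)
    have := (abs_le.1 h').1
    linarith
  have hmono : ∫ _W, Real.exp (-(2 * |B|)) ∂(haarProbability (SU 2)) ≤ linkZ B :=
    integral_mono (integrable_const _)
      (integrable_of_continuous (Real.continuous_exp.comp (continuous_const.mul continuous_trace_re))) hle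
  rw [integral_const, smul_eq_mul, probReal_univ, one_mul] at hmono
  exact lt_of_lt_of_le (Real.exp_pos _) hmono

/-- `linkMean B = I₂(2B)/I₁(2B)` for `B > 0` (tree: Montvay–Münster (3.173), (7.69)). [folklore] -/
theorem linkMean_eq_besselI_div {B : ℝ} (hB : 0 < B) : linkMean B = besselI 2 (2 * B) / besselI 1 (2 * B) := by
  have h := SU2OneLink.integral_re_trace_mul_exp_div_eq B hB
  have hN : linkN B = 1 / 2 * ∫ W, (W.1.trace).re * Real.exp (B * (W.1.trace).re) ∂(haarProbability (SU 2)) := by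
    unfold linkN
    rw [← integral_const_mul]
    refine integral_congr_ae (Filter.Eventually.of_forall fun W => ?_)
    ring
  unfold linkMean
  rw [hN, mul_div_assoc]
  unfold linkZ
  rw [h]
  ring

/-- `I_n(0) = 0` for `n ≥ 1` (all terms of the power series vanish). [folklore] -/
theorem besselI_succ_zero (n : ℕ) : besselI (n + 1) 0 = 0 := by
  have h := Literature.Analysis.FunctionSpaces.hasSum_besselI (n + 1) 0
  have h0 : (fun k : ℕ => ((0 : ℝ) / 2) ^ (2 * k + (n + 1)) / ((k.factorial : ℝ) * ((k + (n + 1)).factorial : ℝ))) =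
      fun _ => 0 := by
    funext k
    rw [zero_div, zero_pow (by omega), zero_div]
  rw [h0] at h
  exact h.unique hasSum_zero

/-- `linkMean 0 = 0` (the Haar mean of `Re tr W` vanishes). [folklore] -/
theorem linkMean_zero : linkMean 0 = 0 := by
  have hN : linkN 0 = 0 := by
    unfold linkN
    have h := SU2OneLink.integral_re_trace_mul_exp_eq_besselI_sub (0 : ℝ)
    have e1 : besselI 1 0 = 0 := besselI_succ_zero 0
    have e3 : besselI 3 0 = 0 := besselI_succ_zero 2
    rw [mul_zero, e1, e3, sub_zero] at h
    have h2 : ∫ W, 1 / 2 * (W.1.trace).re * Real.exp (0 * (W.1.trace).re) ∂(haarProbability (SU 2)) =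
        1 / 2 * ∫ W, (W.1.trace).re * Real.exp (0 * (W.1.trace).re) ∂(haarProbability (SU 2)) := by
      rw [← integral_const_mul]
      refine integral_congr_ae (Filter.Eventually.of_forall fun W => ?_)
      ring
    rw [h2, h, mul_zero]
  unfold linkMean
  rw [hN, zero_div]

/-- `0 ≤ linkMean B` for `B ≥ 0`. [folklore] -/
theorem linkMean_nonneg {B : ℝ} (hB : 0 ≤ B) : 0 ≤ linkMean B := by
  rcases hB.eq_or_lt with h | h
  · rw [← h, linkMean_zero]
  · rw [linkMean_eq_besselI_div h]
    exact div_nonneg (Literature.Analysis.FunctionSpaces.besselI_nonneg 2 (by linarith))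
      (Literature.Analysis.FunctionSpaces.besselI_nonneg 1 (by linarith))

/-- **Transfer of a certified Bessel-ratio bound**: if `I₂(x)/I₁(x) ≤ ρ` for all `0 < x ≤ X` and `0 ≤ ρ`, then
`linkMean B ≤ ρ` for all `0 ≤ B` with `2B ≤ X`. (With the tree's `strictMonoOn_besselI_two_div_one` a single
point check at `x = X` suffices; that packaging is done in the `Instrument` file.) [folklore] -/
theorem linkMean_le_of_besselRatio_le {ρ X B : ℝ} (hρ : 0 ≤ ρ)
    (hX : ∀ x : ℝ, 0 < x → x ≤ X → besselI 2 x / besselI 1 x ≤ ρ) (hB : 0 ≤ B) (hBX : 2 * B ≤ X) :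
    linkMean B ≤ ρ := by
  rcases hB.eq_or_lt with h | h
  · rw [← h, linkMean_zero]; exact hρ
  · rw [linkMean_eq_besselI_div h]; exact hX _ (by linarith) hBX

/-! ## §4 The one-link mean against a quaternionic source `K = quatMatrix k = ‖k‖ · V` -/

/-- **Polar form**: `quatMatrix k = ‖k‖ · (quatToSU2 k)` for every quaternion `k` (at `k = 0` both sides vanish).
[folklore] -/
theorem quatMatrix_eq_norm_smul (k : Quaternion ℝ) :
    quatMatrix k = ((‖k‖ : ℝ) : ℂ) • (quatToSU2 k).1 := by
  by_cases hk : k = 0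
  · subst hk
    have : quatMatrix (0 : Quaternion ℝ) = 0 := by
      rw [← zero_smul ℝ (1 : Quaternion ℝ), quatMatrix_smul, quatMatrix_one]; simp
    rw [this, norm_zero]; simp
  · rw [coe_quatToSU2 hk, quatMatrix_smul, smul_smul]
    have hn : (‖k‖ : ℝ) ≠ 0 := norm_ne_zero_iff.2 hk
    rw [show ((‖k‖ : ℝ) : ℂ) * ((‖k‖⁻¹ : ℝ) : ℂ) = 1 by
      rw [← Complex.ofReal_mul, mul_inv_cancel₀ hn, Complex.ofReal_one], one_smul]

/-- The source term in polar form: `Re tr(W · quatMatrix k) = ‖k‖ · Re tr(W V)`, `V = quatToSU2 k`. [folklore] -/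
theorem re_trace_mul_quatMatrix (W : SU 2) (k : Quaternion ℝ) :
    (W.1 * quatMatrix k).trace.re = ‖k‖ * ((W * quatToSU2 k).1.trace).re := by
  rw [quatMatrix_eq_norm_smul, Matrix.mul_smul, Matrix.trace_smul, smul_eq_mul, Complex.re_ofReal_mul]
  rfl

/-- The one-link partition function against the source `K`: `∫ e^{t Re tr(W K)} dW = Z(t‖k‖)` (right translation
by `V⁻¹`). [folklore] -/
theorem integral_exp_source (t : ℝ) (k : Quaternion ℝ) :
    ∫ W, Real.exp (t * (W.1 * quatMatrix k).trace.re) ∂(haarProbability (SU 2)) = linkZ (t * ‖k‖) := by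
  simp_rw [re_trace_mul_quatMatrix]
  have h := integral_mul_right_eq_self (μ := haarProbability (SU 2))
    (fun W : SU 2 => Real.exp (t * (‖k‖ * ((W * quatToSU2 k).1.trace).re))) (quatToSU2 k)⁻¹
  simp only [inv_mul_cancel_right] at h
  rw [← h]
  unfold linkZ
  refine integral_congr_ae (Filter.Eventually.of_forall fun W => ?_)
  simp only [mul_assoc]

/-- **THE ONE-LINK MEAN (Creutz's heat bath, matrix form).** For `t ≥ 0`… in fact for every real `t`, every
quaternion `k` and every `S ∈ SU(2)`:
`∫ Re tr(W S) e^{t Re tr(W·quatMatrix k)} dW = linkMean(t‖k‖) · Re tr(V⁻¹ S) · ∫ e^{t Re tr(W·quatMatrix k)} dW`,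
`V = quatToSU2 k` — i.e. the conditional mean of a link variable with staple sum `K = ‖k‖V` is `linkMean(t‖k‖) V†`
(Creutz, Phys. Rev. D 21 (1980) 2308, §III). [folklore] -/
theorem integral_re_trace_mul_exp_source (t : ℝ) (k : Quaternion ℝ) (S : SU 2) :
    ∫ W, ((W * S).1.trace).re * Real.exp (t * (W.1 * quatMatrix k).trace.re) ∂(haarProbability (SU 2)) =
      linkMean (t * ‖k‖) * (((quatToSU2 k)⁻¹ * S).1.trace).re *
        ∫ W, Real.exp (t * (W.1 * quatMatrix k).trace.re) ∂(haarProbability (SU 2)) := by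
  rw [integral_exp_source]
  simp_rw [re_trace_mul_quatMatrix]
  set V := quatToSU2 k with hV
  -- right translation by `V⁻¹`
  have h := integral_mul_right_eq_self (μ := haarProbability (SU 2))
    (fun W : SU 2 => ((W * S).1.trace).re * Real.exp (t * (‖k‖ * ((W * V).1.trace).re))) V⁻¹
  simp only [inv_mul_cancel_right] at h
  rw [← h]
  have h2 : ∀ W : SU 2, ((W * V⁻¹ * S).1.trace).re * Real.exp (t * (‖k‖ * ((W.1).trace).re)) =
      (W.1 * (V⁻¹ * S).1).trace.re * Real.exp (t * ‖k‖ * (W.1.trace).re) := by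
    intro W
    rw [mul_assoc W, Submonoid.coe_mul, mul_assoc t]
  simp_rw [h2]
  rw [integral_re_trace_mul_weight (V⁻¹ * S).1 (fun r => Real.exp (t * ‖k‖ * r)) (by fun_prop)]
  have hZ := linkZ_pos (t * ‖k‖)
  have hN : linkN (t * ‖k‖) =
      1 / 2 * ∫ W, (W.1.trace).re * Real.exp (t * ‖k‖ * (W.1.trace).re) ∂(haarProbability (SU 2)) := by
    unfold linkN
    rw [← integral_const_mul]
    refine integral_congr_ae (Filter.Eventually.of_forall fun W => ?_)
    ring
  unfold linkMean
  rw [hN]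
  set I := ∫ W, (W.1.trace).re * Real.exp (t * ‖k‖ * (W.1.trace).re) ∂(haarProbability (SU 2)) with hI
  have h3 : 1 / 2 * I / linkZ (t * ‖k‖) * (↑(V⁻¹ * S) : Matrix (Fin 2) (Fin 2) ℂ).trace.re * linkZ (t * ‖k‖) =
      1 / 2 * (↑(V⁻¹ * S) : Matrix (Fin 2) (Fin 2) ℂ).trace.re * I * (linkZ (t * ‖k‖) / linkZ (t * ‖k‖)) := by
    ring
  rw [h3, div_self hZ.ne', mul_one]

/-- Corollary in the normalisation of the loop variable `½ Re tr`: the conditional mean of `½ Re tr(W S)`.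
[folklore] -/
theorem integral_half_re_trace_mul_exp_source (t : ℝ) (k : Quaternion ℝ) (S : SU 2) :
    ∫ W, 1 / 2 * ((W * S).1.trace).re * Real.exp (t * (W.1 * quatMatrix k).trace.re) ∂(haarProbability (SU 2)) =
      linkMean (t * ‖k‖) * (1 / 2 * (((quatToSU2 k)⁻¹ * S).1.trace).re) *
        ∫ W, Real.exp (t * (W.1 * quatMatrix k).trace.re) ∂(haarProbability (SU 2)) := by
  have h := integral_re_trace_mul_exp_source t k S
  have h1 : ∫ W, 1 / 2 * ((W * S).1.trace).re * Real.exp (t * (W.1 * quatMatrix k).trace.re)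
      ∂(haarProbability (SU 2)) = 1 / 2 * ∫ W, ((W * S).1.trace).re *
        Real.exp (t * (W.1 * quatMatrix k).trace.re) ∂(haarProbability (SU 2)) := by
    rw [← integral_const_mul]
    refine integral_congr_ae (Filter.Eventually.of_forall fun W => ?_)
    ring
  rw [h1, h]
  ring

end SU2OneLink

end Summit.QuantumFields.GaugeBoot

end
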